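import Literature.Probability.RandomPlanarGeometry.ConformalRectangle
import HarnessLib

/-!
# The Cayley transform; Carathéodory's theorem and chordal uniformizing maps in half-plane form (trunk `Stoch`)

`Literature.Probability.RandomPlanarGeometry.ConformalMap` vendors the Riemann mapping theorem and
Carathéodory's theorem in their printed **disc forms** (`Literature.Probability.RandomPlanarGeometry.exists_conformalEquiv_ball`, Ahlfors
(1979), Ch. 6 §1.1, Thm 1; `Literature.Probability.RandomPlanarGeometry.JordanDomain.exists_continuousOn_extension`: a conformal
equivalence of the unit disc onto a Jordan domain extends continuously to the closed disc,
bijectively onto the closure, circle onto the boundary, Pommerenke (1992), Thm 2.6) together with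
**half-plane consequences** used by the chordal SLE files, each as its own named fact "via the
Cayley transform": `exists_conformalEquiv_upperHalfPlaneSet`, `JordanDomain.exists_hasBoundaryValue`,
`JordanDomain.exists_hasBoundaryValueAtInfty`, `JordanDomain.continuousOn_boundaryExtension`,
`JordanDomain.mapsTo_boundaryExtension`, and (in
`Literature.Probability.RandomPlanarGeometry.ConformalRectangle`)
`MarkedDomain.exists_isChordalUniformizing` (every Dobrushin domain `(D; a, b)` is the image of
`(ℍₒ; 0, ∞)` under a conformal equivalence with boundary value `a` at `0` and `b` at `∞`). This
file supplies the Cayley transform as a bundled `Literature.ConformalEquiv ℍₒ 𝔻` and **proves all six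
half-plane statements from the disc forms** (plus, for the last one, simple connectivity of
Jordan domains, `Literature.Probability.RandomPlanarGeometry.JordanDomain.isSimplyConnected`, the Jordan–Schoenflies input, kept as a
hypothesis), so that the only remaining literature inputs are the printed theorems.

* `Literature.cayleyFun z = (z - i)/(z + i)`, `Literature.cayleyInvFun w = i(1 + w)/(1 - w)`, and
  `Literature.cayley : ConformalEquiv ℍₒ (ball 0 1)`; `|cayleyFun z| < 1 ↔ 0 < im z` (for `z ≠ -i`),
  `|cayleyFun x| = 1` for real `x`, `cayleyFun → 1` at infinity, continuity on
  `{z | z ≠ -i} ⊇ closure ℍₒ`; a unit complex number `ζ ≠ 1` is `cayleyFun u` for the real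
  `u = cayleyInvFun ζ`;
* `Literature.rotBall η` (rotation of `𝔻` by a unit `η`) and `Literature.addRealUpperHalfPlane u` (real
  translation of `ℍₒ`) as conformal automorphisms;
* `Literature.Probability.RandomPlanarGeometry.JordanDomain.tendsto_nhdsWithin_of_extension`: if `Ψ` is a continuous extension to the
  closed disc of `φ ∘ cayley⁻¹`, then `φ → Ψ (cayleyFun x)` along `𝓝[ℍₒ] x` for every `x` with
  `im x ≥ 0`, and `φ → Ψ 1` at infinity (`tendsto_cocompact_of_extension`);
* `Literature.Probability.RandomPlanarGeometry.JordanDomain.exists_continuousOn_closedBall_extension` — the named fact "Carathéodory's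
  continuity theorem" (Pommerenke (1992), Thm 2.1, (ii) ⇒ (i): a conformal map of `𝔻` onto a
  Jordan domain extends continuously to `𝔻̄`), the JCT-free part of Thm 2.6, together with the
  proved consequences `mapsTo_closure_of_extension`, `mapsTo_frontier_of_extension`,
  `surjOn_frontier_of_extension` (a continuous extension automatically maps `𝔻̄` into `D̄` and
  the circle onto `∂D`), and the reductions `…_of_closedBall` of all the half-plane facts to it;
* the reductions `JordanDomain.continuousOn_boundaryExtension_of_disc`,
  `JordanDomain.mapsTo_boundaryExtension_of_disc`, `JordanDomain.exists_hasBoundaryValue_of_disc`,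
  `JordanDomain.exists_hasBoundaryValueAtInfty_of_disc`,
  `exists_conformalEquiv_upperHalfPlaneSet_of_ball` and
  `MarkedDomain.exists_isChordalUniformizing_of_disc`. Construction of the last: let `ψ : 𝔻 → D`
  be the inverse of a Riemann map `D → 𝔻`, with Carathéodory extension `Ψ`, and `ζ_a ≠ ζ_b` the
  points of the unit circle with `Ψ ζ_a = a`, `Ψ ζ_b = b`; rotate the disc so that `1 ↦ ζ_b`;
  the rotated preimage `ζ = ζ_b⁻¹ ζ_a ≠ 1` of `a` is `cayleyFun u` for a real `u`; then
  `φ = ψ ∘ (ζ_b ·) ∘ cayley ∘ (· + u)` has boundary value `a` at `0` and `b` at `∞`.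

## Mathlib

We USE `extendFrom` / `continuousOn_extendFrom` (a function with limits within `A` at every
point of `B ⊆ closure A` has a continuous extension on `B`), `DifferentiableOn.div`,
`Complex.normSq`, `tendsto_inv₀_cobounded`, `Metric.cobounded_eq_cocompact`,
`Homeomorph.toCocompactMap`.

## References

* Ch. Pommerenke, *Boundary Behaviour of Conformal Maps* (1992), Thm 2.1 (continuity theorem),
  Thm 2.6 (Carathéodory) and §1.2 (the Cayley transform between disc and half-plane).
* L. V. Ahlfors, *Complex Analysis* (1979), Ch. 6 §1.1, Thm 1 (Riemann mapping); Ch. 3 §3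
  (linear fractional transformations).
* G. F. Lawler, *Conformally Invariant Processes in the Plane* (2005), Ch. 6 (chordal
  normalisation `0 ↦ a`, `∞ ↦ b`).
-/

open Set Filter Topology Complex Metric
open UpperHalfPlane (upperHalfPlaneSet isOpen_upperHalfPlaneSet)

noncomputable section

namespace Literature.Probability.RandomPlanarGeometry

/-! ### The Cayley transform -/

/-- The **Cayley transform** `z ↦ (z - i)/(z + i)` as a function `ℂ → ℂ` (junk value `0/0 = 0`
at `z = -i`); it maps `ℍₒ` onto the unit disc, `ℝ` into the unit circle and `∞ ↦ 1`.
Ahlfors (1979), Ch. 3 §3; Pommerenke (1992), §1.2. [folklore] -/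
def cayleyFun (z : ℂ) : ℂ :=
  (z - I) / (z + I)

/-- The **inverse Cayley transform** `w ↦ i(1 + w)/(1 - w)` (junk value at `w = 1`); it maps the
unit disc onto `ℍₒ`. Ahlfors (1979), Ch. 3 §3. [folklore] -/
def cayleyInvFun (w : ℂ) : ℂ :=
  I * (1 + w) / (1 - w)

/-- Unfolding `cayleyFun`. [folklore] -/
theorem cayleyFun_apply (z : ℂ) : cayleyFun z = (z - I) / (z + I) := rfl

/-- Unfolding `cayleyInvFun`. [folklore] -/
theorem cayleyInvFun_apply (w : ℂ) : cayleyInvFun w = I * (1 + w) / (1 - w) := rfl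

/-- `|z + i|² - |z - i|² = 4 im z`. [folklore] -/
theorem normSq_add_I_sub_normSq_sub_I (z : ℂ) : normSq (z + I) - normSq (z - I) = 4 * z.im := by
  simp only [normSq_apply, add_re, I_re, add_zero, add_im, I_im, sub_re, sub_zero, sub_im]
  ring

/-- `z + i ≠ 0` as soon as `im z ≥ 0` (indeed `im (z + i) = im z + 1 > 0`). [folklore] -/
theorem add_I_ne_zero {z : ℂ} (hz : 0 ≤ z.im) : z + I ≠ 0 := by
  intro h
  have := congrArg Complex.im h
  simp only [add_im, I_im, zero_im] at this
  linarith

/-- The Cayley transform maps into the open unit disc exactly the open upper half-plane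
(away from the pole `-i`). [folklore] -/
theorem norm_cayleyFun_lt_one_iff {z : ℂ} (hz : z + I ≠ 0) : ‖cayleyFun z‖ < 1 ↔ 0 < z.im := by
  rw [cayleyFun_apply, norm_div, div_lt_one (norm_pos_iff.2 hz),
    ← sq_lt_sq₀ (norm_nonneg _) (norm_nonneg _), ← normSq_eq_norm_sq, ← normSq_eq_norm_sq,
    ← sub_pos, normSq_add_I_sub_normSq_sub_I]
  constructor <;> intro h <;> linarith

/-- The Cayley transform maps the closed upper half-plane into the closed unit disc. [folklore] -/
theorem norm_cayleyFun_le_one {z : ℂ} (hz : 0 ≤ z.im) : ‖cayleyFun z‖ ≤ 1 := by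
  rw [cayleyFun_apply, norm_div, div_le_one (norm_pos_iff.2 (add_I_ne_zero hz)),
    ← sq_le_sq₀ (norm_nonneg _) (norm_nonneg _), ← normSq_eq_norm_sq, ← normSq_eq_norm_sq,
    ← sub_nonneg, normSq_add_I_sub_normSq_sub_I]
  linarith

/-- The Cayley transform maps the real line into the unit circle. [folklore] -/
theorem norm_cayleyFun_ofReal (x : ℝ) : ‖cayleyFun x‖ = 1 := by
  have hx : (x : ℂ) + I ≠ 0 := add_I_ne_zero (by simp)
  rw [cayleyFun_apply, norm_div, div_eq_one_iff_eq (norm_ne_zero_iff.2 hx),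
    ← sq_eq_sq₀ (norm_nonneg _) (norm_nonneg _), ← normSq_eq_norm_sq, ← normSq_eq_norm_sq,
    ← sub_eq_zero, ← neg_sub, normSq_add_I_sub_normSq_sub_I]
  simp

/-- Imaginary part of the inverse Cayley transform: `im (i(1+w)/(1-w)) = (1 - |w|²)/|1 - w|²`. [folklore] -/
theorem cayleyInvFun_im (w : ℂ) : (cayleyInvFun w).im = (1 - normSq w) / normSq (1 - w) := by
  rw [cayleyInvFun_apply, mul_div_assoc, mul_im, I_re, I_im, zero_mul, one_mul, zero_add, div_re,
    ← add_div]
  congr 1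
  simp only [add_re, one_re, sub_re, add_im, one_im, sub_im, zero_add, zero_sub, normSq_apply]
  ring

/-- The inverse Cayley transform maps the open unit disc into the open upper half-plane. [folklore] -/
theorem cayleyInvFun_im_pos {w : ℂ} (hw : ‖w‖ < 1) : 0 < (cayleyInvFun w).im := by
  have hw1 : w ≠ 1 := by
    rintro rfl
    simp at hw
  rw [cayleyInvFun_im]
  refine div_pos ?_ (normSq_pos.2 (sub_ne_zero.2 (Ne.symm hw1)))
  rw [sub_pos, normSq_eq_norm_sq]
  exact (sq_lt_one_iff₀ (norm_nonneg _)).2 hw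

/-- `cayleyInvFun` is a left inverse of `cayleyFun` away from the pole `-i`. [folklore] -/
theorem cayleyInvFun_cayleyFun {z : ℂ} (hz : z + I ≠ 0) : cayleyInvFun (cayleyFun z) = z := by
  rw [cayleyFun_apply, cayleyInvFun_apply]
  have h1 : 1 - (z - I) / (z + I) = 2 * I / (z + I) := by
    field_simp
    ring
  have h2 : 1 + (z - I) / (z + I) = 2 * z / (z + I) := by
    field_simp
    ring
  rw [h1, h2]
  field_simp

/-- `cayleyFun` is a left inverse of `cayleyInvFun` away from the pole `1`. [folklore] -/
theorem cayleyFun_cayleyInvFun {w : ℂ} (hw : w ≠ 1) : cayleyFun (cayleyInvFun w) = w := by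
  have hw' : (1 : ℂ) - w ≠ 0 := sub_ne_zero.2 (Ne.symm hw)
  rw [cayleyFun_apply, cayleyInvFun_apply]
  have h1 : I * (1 + w) / (1 - w) - I = 2 * I * w / (1 - w) := by
    field_simp
    ring
  have h2 : I * (1 + w) / (1 - w) + I = 2 * I / (1 - w) := by
    field_simp
    ring
  rw [h1, h2]
  field_simp

/-- The Cayley transform is holomorphic away from `-i`. [folklore] -/
theorem differentiableOn_cayleyFun : DifferentiableOn ℂ cayleyFun {z | z + I ≠ 0} :=
  (differentiableOn_id.sub_const I).div (differentiableOn_id.add_const I) fun _ hz ↦ hz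

/-- The Cayley transform is continuous away from `-i`, in particular on the closed upper
half-plane. [folklore] -/
theorem continuousOn_cayleyFun : ContinuousOn cayleyFun {z | z + I ≠ 0} :=
  differentiableOn_cayleyFun.continuousOn

/-- The inverse Cayley transform is holomorphic away from `1`. [folklore] -/
theorem differentiableOn_cayleyInvFun : DifferentiableOn ℂ cayleyInvFun {w | w ≠ 1} :=
  ((differentiableOn_const I).mul (differentiableOn_id.const_add 1)).div
    (differentiableOn_id.const_sub 1) fun _ hw ↦ sub_ne_zero.2 (Ne.symm hw)

/-- **The Cayley transform** `ℍₒ → 𝔻`, `z ↦ (z - i)/(z + i)`, with inverse `w ↦ i(1 + w)/(1 - w)`,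
as a bundled conformal equivalence between the open upper half-plane and the open unit disc.
Ahlfors (1979), Ch. 3 §3; Pommerenke (1992), §1.2. [folklore] -/
def cayley : ConformalEquiv upperHalfPlaneSet (ball (0 : ℂ) 1) where
  toFun := cayleyFun
  invFun := cayleyInvFun
  source := upperHalfPlaneSet
  target := ball 0 1
  map_source' z hz := by
    have hz' : 0 < z.im := hz
    rw [mem_ball_zero_iff, norm_cayleyFun_lt_one_iff (add_I_ne_zero hz'.le)]
    exact hz'
  map_target' w hw := cayleyInvFun_im_pos (mem_ball_zero_iff.1 hw)
  left_inv' z hz := cayleyInvFun_cayleyFun (add_I_ne_zero (le_of_lt hz))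
  right_inv' w hw := by
    refine cayleyFun_cayleyInvFun ?_
    rintro rfl
    simp at hw
  source_eq := rfl
  target_eq := rfl
  differentiableOn := differentiableOn_cayleyFun.mono fun _ hz ↦ add_I_ne_zero (le_of_lt hz)
  differentiableOn_symm := differentiableOn_cayleyInvFun.mono fun w hw ↦ by
    rintro rfl
    simp at hw

/-- The Cayley conformal equivalence acts as `cayleyFun`. [folklore] -/
@[simp] theorem cayley_apply (z : ℂ) : cayley z = cayleyFun z := rfl

/-- The inverse of the Cayley conformal equivalence acts as `cayleyInvFun`. [folklore] -/
@[simp] theorem cayley_symm_apply (w : ℂ) : cayley.symm w = cayleyInvFun w := rfl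

/-- **The Cayley transform at infinity**: `(z - i)/(z + i) = 1 - 2i/(z + i) → 1` as `z → ∞`. [folklore] -/
theorem tendsto_cayleyFun_cocompact : Tendsto cayleyFun (cocompact ℂ) (𝓝 1) := by
  have h1 : Tendsto (fun z : ℂ ↦ z + I) (cocompact ℂ) (cocompact ℂ) :=
    (Homeomorph.addRight I).toCocompactMap.cocompact_tendsto'
  have h2 : Tendsto (fun z : ℂ ↦ (z + I)⁻¹) (cocompact ℂ) (𝓝 0) := by
    rw [← cobounded_eq_cocompact] at h1 ⊢
    exact tendsto_inv₀_cobounded.comp h1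
  have h3 : Tendsto (fun z : ℂ ↦ 1 - 2 * I * (z + I)⁻¹) (cocompact ℂ) (𝓝 (1 - 2 * I * 0)) :=
    tendsto_const_nhds.sub (h2.const_mul _)
  rw [mul_zero, sub_zero] at h3
  refine h3.congr' ?_
  have hev : ∀ᶠ z : ℂ in cocompact ℂ, z + I ≠ 0 := by
    have : ∀ᶠ z : ℂ in cocompact ℂ, z ∈ ({-I} : Set ℂ)ᶜ :=
      (hasBasis_cocompact.mem_iff).2 ⟨{-I}, isCompact_singleton, Subset.rfl⟩
    filter_upwards [this] with z hz
    rw [mem_compl_iff, mem_singleton_iff] at hz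
    rwa [Ne, add_eq_zero_iff_eq_neg]
  filter_upwards [hev] with z hz
  rw [cayleyFun_apply]
  field_simp
  ring

/-! ### Carathéodory: from the disc form to the half-plane forms -/

/-- `closure ℍₒ = {z | 0 ≤ im z}` (Mathlib `Complex.closure_setOf_lt_im`). [folklore] -/
theorem mem_closure_upperHalfPlaneSet_iff {z : ℂ} : z ∈ closure upperHalfPlaneSet ↔ 0 ≤ z.im := by
  rw [show closure upperHalfPlaneSet = {z : ℂ | 0 ≤ z.im} from closure_setOf_lt_im 0]
  rfl

namespace JordanDomain

variable {D : JordanDomain} (φ : ConformalEquiv upperHalfPlaneSet D.carrier)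

/-- If `Ψ` extends `φ ∘ cayley⁻¹ : 𝔻 → D` to the closed disc, then `φ = Ψ ∘ cayleyFun` on `ℍₒ`. [folklore] -/
theorem eqOn_comp_cayleyFun {Ψ : ℂ → ℂ} (hΨeq : EqOn Ψ (cayley.symm.trans φ) (ball 0 1)) :
    EqOn φ (Ψ ∘ cayleyFun) upperHalfPlaneSet := by
  intro z hz
  have hz' : cayleyFun z ∈ ball (0 : ℂ) 1 := cayley.mapsTo hz
  rw [Function.comp_apply, hΨeq hz', ConformalEquiv.trans_apply, cayley_symm_apply,
    cayleyInvFun_cayleyFun (add_I_ne_zero (le_of_lt hz))]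

/-- **Limits of `φ : ℍₒ → D` at finite boundary points from the disc extension.** If `Ψ` is
continuous on the closed unit disc and extends `φ ∘ cayley⁻¹`, then `φ z → Ψ (cayleyFun x)` as
`z → x` within `ℍₒ`, for every `x` of the closed upper half-plane. Pommerenke (1992), §1.2 and
Thm 2.6. [folklore] -/
theorem tendsto_nhdsWithin_of_extension {Ψ : ℂ → ℂ} (hΨc : ContinuousOn Ψ (closedBall 0 1))
    (hΨeq : EqOn Ψ (cayley.symm.trans φ) (ball 0 1)) {x : ℂ} (hx : 0 ≤ x.im) :
    Tendsto φ (𝓝[upperHalfPlaneSet] x) (𝓝 (Ψ (cayleyFun x))) := by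
  have hmaps : MapsTo cayleyFun upperHalfPlaneSet (closedBall (0 : ℂ) 1) :=
    fun z hz ↦ mem_closedBall_zero_iff.2 (norm_cayleyFun_le_one (le_of_lt hz))
  have hC : Tendsto cayleyFun (𝓝[upperHalfPlaneSet] x) (𝓝[closedBall 0 1] (cayleyFun x)) := by
    have hcx : ContinuousWithinAt cayleyFun upperHalfPlaneSet x :=
      ((continuousOn_cayleyFun x (add_I_ne_zero hx)).continuousAt
        ((isOpen_ne_fun (continuous_id.add continuous_const) continuous_const).mem_nhds
          (add_I_ne_zero hx))).continuousWithinAt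
    exact hcx.tendsto_nhdsWithin hmaps
  have hΨ : Tendsto Ψ (𝓝[closedBall 0 1] (cayleyFun x)) (𝓝 (Ψ (cayleyFun x))) :=
    hΨc _ (mem_closedBall_zero_iff.2 (norm_cayleyFun_le_one hx))
  exact (hΨ.comp hC).congr' ((eqOn_comp_cayleyFun φ hΨeq).symm.eventuallyEq_nhdsWithin)

/-- **Limit of `φ : ℍₒ → D` at infinity from the disc extension**: `φ z → Ψ 1` as `z → ∞`
within `ℍₒ`. Pommerenke (1992), §1.2 and Thm 2.6. [folklore] -/
theorem tendsto_cocompact_of_extension {Ψ : ℂ → ℂ} (hΨc : ContinuousOn Ψ (closedBall 0 1))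
    (hΨeq : EqOn Ψ (cayley.symm.trans φ) (ball 0 1)) :
    Tendsto φ (cocompact ℂ ⊓ 𝓟 upperHalfPlaneSet) (𝓝 (Ψ 1)) := by
  have hmaps : MapsTo cayleyFun upperHalfPlaneSet (closedBall (0 : ℂ) 1) :=
    fun z hz ↦ mem_closedBall_zero_iff.2 (norm_cayleyFun_le_one (le_of_lt hz))
  have hC : Tendsto cayleyFun (cocompact ℂ ⊓ 𝓟 upperHalfPlaneSet) (𝓝[closedBall 0 1] 1) :=
    tendsto_nhdsWithin_iff.2 ⟨tendsto_cayleyFun_cocompact.mono_left inf_le_left,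
      eventually_inf_principal.2 (Eventually.of_forall hmaps)⟩
  have hΨ : Tendsto Ψ (𝓝[closedBall 0 1] 1) (𝓝 (Ψ 1)) :=
    hΨc 1 (mem_closedBall_zero_iff.2 (by simp))
  refine (hΨ.comp hC).congr' ?_
  exact eventually_inf_principal.2 (Eventually.of_forall fun z hz ↦
    ((eqOn_comp_cayleyFun φ hΨeq) hz).symm)

/-! ### Carathéodory's continuity theorem (Pommerenke Thm 2.1) and what it yields -/

/-- **Carathéodory's continuity theorem for Jordan domains** (disc form; the continuity part of
`exists_continuousOn_extension`): a conformal equivalence of the unit disc onto a Jordan domain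
`D` extends continuously to the closed disc. This is Pommerenke's Theorem 2.1, (ii) ⇒ (i): for
`f` mapping `𝔻` conformally onto a bounded domain `G`, "`f` has a continuous extension to `𝔻̄`"
is equivalent to "`∂G` is a curve" (and to local connectivity of `∂G`, resp. of `ℂ \ G`); for a
Jordan domain `∂D = range D.boundary` is a curve by definition. Its proof (Wolff's length–area
lemma, Prop. 2.2, and Janiszewski's theorem) uses neither the Jordan curve theorem nor
injectivity of the boundary loop, unlike the bijectivity clauses of Thm 2.6
(`exists_continuousOn_extension`, which implies the present statement,
`exists_continuousOn_closedBall_extension_of_extension`). Everything the chordal SLE files need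
follows from this weaker statement (below). Pommerenke, *Boundary Behaviour of Conformal Maps*
(1992), Thm 2.1. [cite: PommerenkeBBCM1992, Thm. 2.1] -/
def exists_continuousOn_closedBall_extension : Prop :=
  ∀ (D : JordanDomain) (ψ : ConformalEquiv (ball (0 : ℂ) 1) D.carrier),
    ∃ Ψ : ℂ → ℂ, ContinuousOn Ψ (closedBall 0 1) ∧ EqOn Ψ ψ (ball 0 1)

/-- Pommerenke's Thm 2.6 (`exists_continuousOn_extension`) trivially implies Thm 2.1 (ii) ⇒ (i)
(`exists_continuousOn_closedBall_extension`). [cite: PommerenkeBBCM1992, Thm. 2.6] -/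
theorem exists_continuousOn_closedBall_extension_of_extension (h : exists_continuousOn_extension) :
    exists_continuousOn_closedBall_extension := fun D ψ ↦ by
  obtain ⟨Ψ, hΨc, hΨeq, -, -⟩ := h D ψ
  exact ⟨Ψ, hΨc, hΨeq⟩

section Extension

variable {ψ : ConformalEquiv (ball (0 : ℂ) 1) D.carrier} {Ψ : ℂ → ℂ}

/-- A continuous extension `Ψ` of `ψ : 𝔻 → D` to the closed disc maps it into `closure D`
(`Ψ(closure 𝔻) ⊆ closure Ψ(𝔻) = closure D`). Pommerenke (1992), §2.2. [folklore] -/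
theorem mapsTo_closure_of_extension (hΨc : ContinuousOn Ψ (closedBall 0 1))
    (hΨeq : EqOn Ψ ψ (ball 0 1)) : MapsTo Ψ (closedBall 0 1) (closure D.carrier) := by
  have hcl : closure (ball (0 : ℂ) 1) = closedBall 0 1 := closure_ball 0 one_ne_zero
  intro z hz
  rw [← hcl] at hz
  have h1 : Ψ z ∈ closure (Ψ '' ball 0 1) := (hcl ▸ hΨc).image_closure ⟨z, hz, rfl⟩
  rw [hΨeq.image_eq, ψ.bijOn.image_eq] at h1
  exact h1

/-- A continuous extension `Ψ` of `ψ : 𝔻 → D` maps the unit circle into `∂D`: if `Ψ ζ ∈ D` for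
some `|ζ| = 1`, continuity of `ψ⁻¹` at `Ψ ζ` would force `z → ψ⁻¹ (Ψ ζ) ∈ 𝔻` as `z → ζ` within
`𝔻`, contradicting `z → ζ`. Pommerenke (1992), §2.2 ("`f(𝔻) = G` is disjoint from
`f(𝕋) = ∂G`"). [folklore] -/
theorem mapsTo_frontier_of_extension (hΨc : ContinuousOn Ψ (closedBall 0 1))
    (hΨeq : EqOn Ψ ψ (ball 0 1)) : MapsTo Ψ (sphere 0 1) (frontier D.carrier) := by
  intro ζ hζ
  have hζ' : ζ ∈ closedBall (0 : ℂ) 1 := sphere_subset_closedBall hζ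
  refine ⟨mapsTo_closure_of_extension hΨc hΨeq hζ', ?_⟩
  rw [D.isOpen.interior_eq]
  intro hD
  -- `w := ψ⁻¹ (Ψ ζ) ∈ 𝔻`
  set w : ℂ := ψ.symm (Ψ ζ) with hw
  have hwball : w ∈ ball (0 : ℂ) 1 := ψ.symm.mapsTo hD
  -- `z → ζ` within `𝔻` forces `ψ⁻¹ (Ψ z) = z → w`
  have hζcl : ζ ∈ closure (ball (0 : ℂ) 1) := by
    rw [closure_ball 0 one_ne_zero]
    exact hζ'
  haveI : (𝓝[ball (0 : ℂ) 1] ζ).NeBot := mem_closure_iff_nhdsWithin_neBot.1 hζcl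
  have h1 : Tendsto Ψ (𝓝[ball 0 1] ζ) (𝓝 (Ψ ζ)) :=
    (hΨc ζ hζ').mono_left (nhdsWithin_mono ζ ball_subset_closedBall)
  have h2 : Tendsto (ψ.symm ∘ Ψ) (𝓝[ball 0 1] ζ) (𝓝 w) :=
    ((ψ.symm.differentiableOn.continuousOn.continuousAt (D.isOpen.mem_nhds hD)).tendsto).comp h1
  have h3 : Tendsto (fun z : ℂ ↦ z) (𝓝[ball 0 1] ζ) (𝓝 w) := by
    refine h2.congr' (eventually_nhdsWithin_of_forall fun z hz ↦ ?_)
    change ψ.symm (Ψ z) = z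
    rw [hΨeq hz, ψ.symm_apply_apply hz]
  have h4 : Tendsto (fun z : ℂ ↦ z) (𝓝[ball 0 1] ζ) (𝓝 ζ) := tendsto_nhdsWithin_of_tendsto_nhds
    tendsto_id
  have hwζ : w = ζ := tendsto_nhds_unique h3 h4
  rw [mem_sphere_zero_iff_norm] at hζ
  have := mem_ball_zero_iff.1 hwball
  rw [hwζ, hζ] at this
  exact lt_irrefl _ this

/-- A continuous extension `Ψ` of `ψ : 𝔻 → D` maps the unit circle **onto** `∂D`: `Ψ(𝔻̄)` is
compact, hence closed, and contains `D`, hence `closure D`; points of `∂D` are not in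
`D = Ψ(𝔻)`. Pommerenke (1992), §2.2. [folklore] -/
theorem surjOn_frontier_of_extension (hΨc : ContinuousOn Ψ (closedBall 0 1))
    (hΨeq : EqOn Ψ ψ (ball 0 1)) : SurjOn Ψ (sphere 0 1) (frontier D.carrier) := by
  intro p hp
  have hcpt : IsCompact (Ψ '' closedBall 0 1) := (isCompact_closedBall 0 1).image_of_continuousOn hΨc
  have hDsub : D.carrier ⊆ Ψ '' closedBall 0 1 := by
    rw [← ψ.bijOn.image_eq, ← hΨeq.image_eq]
    exact image_mono ball_subset_closedBall
  have hclsub : closure D.carrier ⊆ Ψ '' closedBall 0 1 :=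
    closure_minimal hDsub hcpt.isClosed
  obtain ⟨z, hz, rfl⟩ := hclsub (frontier_subset_closure hp)
  refine ⟨z, ?_, rfl⟩
  have hz1 : ‖z‖ ≤ 1 := mem_closedBall_zero_iff.1 hz
  rcases hz1.lt_or_eq with hlt | heq
  · exfalso
    have hzball : z ∈ ball (0 : ℂ) 1 := mem_ball_zero_iff.2 hlt
    have hmem : Ψ z ∈ D.carrier := hΨeq hzball ▸ ψ.mapsTo hzball
    rw [frontier, D.isOpen.interior_eq] at hp
    exact hp.2 hmem
  · exact mem_sphere_zero_iff_norm.2 heq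

end Extension

/-- **Carathéodory, half-plane form, from the continuity theorem: continuity of the boundary
extension.** `JordanDomain.continuousOn_boundaryExtension` follows from
`JordanDomain.exists_continuousOn_closedBall_extension` (Pommerenke (1992), Thm 2.1) via the
Cayley transform: `φ` has the limit `Ψ (cayleyFun x)` within `ℍₒ` at every point `x` of the
closed half-plane, so `extendFrom ℍₒ φ` is continuous there (`continuousOn_extendFrom`). [cite: PommerenkeBBCM1992, Thm. 2.1] -/
theorem continuousOn_boundaryExtension_of_closedBall (h : exists_continuousOn_closedBall_extension) :
    continuousOn_boundaryExtension := by
  intro D φ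
  obtain ⟨Ψ, hΨc, hΨeq⟩ := h D (cayley.symm.trans φ)
  refine continuousOn_extendFrom Subset.rfl fun x hx ↦ ?_
  exact ⟨_, tendsto_nhdsWithin_of_extension φ hΨc hΨeq
    ((mem_closure_upperHalfPlaneSet_iff).1 hx)⟩

/-- **Carathéodory, half-plane form, from the disc form: continuity of the boundary extension.**
`JordanDomain.continuousOn_boundaryExtension` follows from `JordanDomain.exists_continuousOn_extension`
(Pommerenke (1992), Thm 2.6) via the Cayley transform: `φ` has the limit `Ψ (cayleyFun x)` within
`ℍₒ` at every point `x` of the closed half-plane, so `extendFrom ℍₒ φ` is continuous there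
(`continuousOn_extendFrom`). [cite: PommerenkeBBCM1992, Thm. 2.6] -/
theorem continuousOn_boundaryExtension_of_disc (h : exists_continuousOn_extension) :
    continuousOn_boundaryExtension :=
  continuousOn_boundaryExtension_of_closedBall (exists_continuousOn_closedBall_extension_of_extension h)

/-- Under the disc extension `Ψ`, the boundary extension of `φ` is `Ψ ∘ cayleyFun` on the closed
half-plane. Pommerenke (1992), §1.2 and Thm 2.6. [folklore] -/
theorem boundaryExtension_eq_of_extension {Ψ : ℂ → ℂ} (hΨc : ContinuousOn Ψ (closedBall 0 1))
    (hΨeq : EqOn Ψ (cayley.symm.trans φ) (ball 0 1)) {x : ℂ} (hx : 0 ≤ x.im) :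
    φ.boundaryExtension x = Ψ (cayleyFun x) :=
  φ.boundaryExtension_eq_of_hasBoundaryValue ((mem_closure_upperHalfPlaneSet_iff).2 hx)
    (tendsto_nhdsWithin_of_extension φ hΨc hΨeq hx)

/-- **Carathéodory, half-plane form, from the continuity theorem: the boundary extension maps the
closed half-plane into `closure D`** (`mapsTo_closure_of_extension`). [cite: PommerenkeBBCM1992, Thm. 2.1] -/
theorem mapsTo_boundaryExtension_of_closedBall (h : exists_continuousOn_closedBall_extension) :
    mapsTo_boundaryExtension := by
  intro D φ x hx
  obtain ⟨Ψ, hΨc, hΨeq⟩ := h D (cayley.symm.trans φ)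
  have hx' : 0 ≤ x.im := (mem_closure_upperHalfPlaneSet_iff).1 hx
  rw [boundaryExtension_eq_of_extension φ hΨc hΨeq hx']
  exact mapsTo_closure_of_extension hΨc hΨeq
    (mem_closedBall_zero_iff.2 (norm_cayleyFun_le_one hx'))

/-- **Carathéodory, half-plane form, from the disc form: the boundary extension maps the closed
half-plane into `closure D`.** [cite: PommerenkeBBCM1992, Thm. 2.6] -/
theorem mapsTo_boundaryExtension_of_disc (h : exists_continuousOn_extension) :
    mapsTo_boundaryExtension :=
  mapsTo_boundaryExtension_of_closedBall (exists_continuousOn_closedBall_extension_of_extension h)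

/-- **Carathéodory, half-plane form, from the continuity theorem: boundary values at real
points**, lying on `∂D` (the circle is mapped into `∂D`, `mapsTo_frontier_of_extension`). [cite: PommerenkeBBCM1992, Thm. 2.1] -/
theorem exists_hasBoundaryValue_of_closedBall (h : exists_continuousOn_closedBall_extension) :
    exists_hasBoundaryValue := by
  intro D φ x
  obtain ⟨Ψ, hΨc, hΨeq⟩ := h D (cayley.symm.trans φ)
  refine ⟨Ψ (cayleyFun x), mapsTo_frontier_of_extension hΨc hΨeq
    (mem_sphere_zero_iff_norm.2 (norm_cayleyFun_ofReal x)), ?_⟩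
  exact tendsto_nhdsWithin_of_extension φ hΨc hΨeq (by simp)

/-- **Carathéodory, half-plane form, from the disc form: boundary values at real points**, lying
on `∂D` (the circle is mapped onto `∂D`). [cite: PommerenkeBBCM1992, Thm. 2.6] -/
theorem exists_hasBoundaryValue_of_disc (h : exists_continuousOn_extension) :
    exists_hasBoundaryValue :=
  exists_hasBoundaryValue_of_closedBall (exists_continuousOn_closedBall_extension_of_extension h)

/-- **Carathéodory, half-plane form, from the disc form: boundary value at infinity**, namely
`Ψ 1 ∈ ∂D`. [cite: PommerenkeBBCM1992, Thm. 2.6] -/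
theorem exists_hasBoundaryValueAtInfty_of_disc (h : exists_continuousOn_extension) :
    exists_hasBoundaryValueAtInfty := by
  intro D φ
  obtain ⟨Ψ, hΨc, hΨeq, -, hsph⟩ := h D (cayley.symm.trans φ)
  exact ⟨Ψ 1, hsph.mapsTo (by simp), tendsto_cocompact_of_extension φ hΨc hΨeq⟩

/-- **Carathéodory, half-plane form, from the continuity theorem: boundary value at infinity**,
namely `Ψ 1 ∈ ∂D`. [cite: PommerenkeBBCM1992, Thm. 2.1] -/
theorem exists_hasBoundaryValueAtInfty_of_closedBall (h : exists_continuousOn_closedBall_extension) :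
    exists_hasBoundaryValueAtInfty := by
  intro D φ
  obtain ⟨Ψ, hΨc, hΨeq⟩ := h D (cayley.symm.trans φ)
  exact ⟨Ψ 1, mapsTo_frontier_of_extension hΨc hΨeq (by simp),
    tendsto_cocompact_of_extension φ hΨc hΨeq⟩

end JordanDomain

/-! ### Rotations of the disc and real translations of the half-plane -/

/-- The **rotation** `w ↦ η w` of the unit disc by a unit complex number `η`, as a conformal
automorphism of `𝔻` with inverse `w ↦ η⁻¹ w`. Ahlfors (1979), Ch. 3 §3. [folklore] -/
def rotBall (η : ℂ) (hη : ‖η‖ = 1) : ConformalEquiv (ball (0 : ℂ) 1) (ball (0 : ℂ) 1) where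
  toFun w := η * w
  invFun w := η⁻¹ * w
  source := ball 0 1
  target := ball 0 1
  map_source' w hw := by
    rw [mem_ball_zero_iff] at hw ⊢
    rwa [norm_mul, hη, one_mul]
  map_target' w hw := by
    rw [mem_ball_zero_iff] at hw ⊢
    rwa [norm_mul, norm_inv, hη, inv_one, one_mul]
  left_inv' w _ := by
    have hη0 : η ≠ 0 := norm_ne_zero_iff.1 (by rw [hη]; exact one_ne_zero)
    rw [← mul_assoc, inv_mul_cancel₀ hη0, one_mul]
  right_inv' w _ := by
    have hη0 : η ≠ 0 := norm_ne_zero_iff.1 (by rw [hη]; exact one_ne_zero)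
    rw [← mul_assoc, mul_inv_cancel₀ hη0, one_mul]
  source_eq := rfl
  target_eq := rfl
  differentiableOn := (differentiableOn_const η).mul differentiableOn_id
  differentiableOn_symm := (differentiableOn_const η⁻¹).mul differentiableOn_id

/-- The rotation acts as `w ↦ η w`. [folklore] -/
@[simp] theorem rotBall_apply (η : ℂ) (hη : ‖η‖ = 1) (w : ℂ) : rotBall η hη w = η * w := rfl

/-- The **real translation** `z ↦ z + u` (`u ∈ ℝ`) of the upper half-plane, as a conformal
automorphism of `ℍₒ` with inverse `z ↦ z - u`. Ahlfors (1979), Ch. 3 §3. [folklore] -/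
def addRealUpperHalfPlane (u : ℝ) : ConformalEquiv upperHalfPlaneSet upperHalfPlaneSet where
  toFun z := z + u
  invFun z := z - u
  source := upperHalfPlaneSet
  target := upperHalfPlaneSet
  map_source' z hz := by
    change 0 < (z + u).im
    simpa using hz
  map_target' z hz := by
    change 0 < (z - u).im
    simpa using hz
  left_inv' z _ := add_sub_cancel_right z u
  right_inv' z _ := sub_add_cancel z u
  source_eq := rfl
  target_eq := rfl
  differentiableOn := differentiableOn_id.add_const _
  differentiableOn_symm := differentiableOn_id.sub_const _

/-- The real translation acts as `z ↦ z + u`. [folklore] -/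
@[simp] theorem addRealUpperHalfPlane_apply (u : ℝ) (z : ℂ) : addRealUpperHalfPlane u z = z + u :=
  rfl

/-- The real translation `z ↦ z + u` tends to `𝓝[ℍₒ] u` along `𝓝[ℍₒ] 0`. [folklore] -/
theorem tendsto_add_real_nhdsWithin_zero (u : ℝ) :
    Tendsto (fun z : ℂ ↦ z + u) (𝓝[upperHalfPlaneSet] 0) (𝓝[upperHalfPlaneSet] u) := by
  have hc : Continuous fun z : ℂ ↦ z + u := continuous_id.add continuous_const
  have h := (hc.continuousWithinAt (s := upperHalfPlaneSet) (x := 0)).tendsto_nhdsWithin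
    (addRealUpperHalfPlane u).mapsTo
  simpa using h

/-- The real translation `z ↦ z + u` preserves the filter "at infinity within `ℍₒ`". [folklore] -/
theorem tendsto_add_real_cocompact_inf (u : ℝ) :
    Tendsto (fun z : ℂ ↦ z + u) (cocompact ℂ ⊓ 𝓟 upperHalfPlaneSet)
      (cocompact ℂ ⊓ 𝓟 upperHalfPlaneSet) :=
  (Homeomorph.addRight (u : ℂ)).toCocompactMap.cocompact_tendsto'.inf
    (tendsto_principal_principal.2 (addRealUpperHalfPlane u).mapsTo)

/-! ### Unit complex numbers and the Cayley transform -/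

/-- A unit complex number `ζ ≠ 1` is the Cayley image of the *real* number `cayleyInvFun ζ`:
the inverse Cayley transform of `ζ` is real. [folklore] -/
theorem cayleyInvFun_im_eq_zero {ζ : ℂ} (hζ : ‖ζ‖ = 1) : (cayleyInvFun ζ).im = 0 := by
  rw [cayleyInvFun_im, normSq_eq_norm_sq, hζ, one_pow, sub_self, zero_div]

/-- For a unit complex number `ζ`, `cayleyInvFun ζ` equals the real number `re (cayleyInvFun ζ)`. [folklore] -/
theorem cayleyInvFun_eq_ofReal_re {ζ : ℂ} (hζ : ‖ζ‖ = 1) :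
    cayleyInvFun ζ = ((cayleyInvFun ζ).re : ℂ) :=
  Complex.ext (by simp) (by rw [ofReal_im, cayleyInvFun_im_eq_zero hζ])

/-! ### The half-plane Riemann mapping theorem from the disc form -/

/-- **Riemann mapping theorem, half-plane form, from the disc form**: compose a Riemann map
`U → 𝔻` with the inverse Cayley transform. Ahlfors (1979), Ch. 6 §1.1, Thm 1. [cite: AhlforsCA1979, Ch. 6 §1.1 Thm. 1] -/
theorem exists_conformalEquiv_upperHalfPlaneSet_of_ball
    (hRM : ∀ {U : Set ℂ}, exists_conformalEquiv_ball (U := U)) {U : Set ℂ} :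
    exists_conformalEquiv_upperHalfPlaneSet (U := U) := by
  intro hU hsc hU'
  obtain ⟨ψ⟩ := hRM hU hsc hU'
  exact ⟨cayley.trans ψ.symm⟩

/-! ### Chordal uniformizing maps -/

namespace MarkedDomain

/-- **Existence of chordal uniformizing maps from Riemann mapping and Carathéodory.** Every
Dobrushin domain `(D; a, b)` admits a conformal equivalence `φ : ℍₒ → D` with boundary value `a`
at `0` and `b` at `∞` (`MarkedDomain.exists_isChordalUniformizing`), given: Jordan domains are
simply connected (`hsc`), the Riemann mapping theorem in disc form (`hRM`, Ahlfors (1979), Ch. 6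
§1.1, Thm 1) and Carathéodory's *continuity* theorem in disc form (`hC`, Pommerenke (1992),
Thm 2.1: only a continuous extension to the closed disc is needed, since it automatically maps
the circle onto `∂D`, `JordanDomain.surjOn_frontier_of_extension`). Proof: inverse Riemann map
`ψ : 𝔻 → D` with continuous extension `Ψ`; circle points `ζ_a ≠ ζ_b` over `a ≠ b`;
`φ = ψ ∘ (ζ_b ·) ∘ cayley ∘ (· + u)` with `u = cayleyInvFun (ζ_b⁻¹ ζ_a) ∈ ℝ`.
Lawler (2005), Ch. 6; Ahlfors (1979), Ch. 6 §1.1. [cite: AhlforsCA1979, Ch. 6 §1.1 Thm. 1] -/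
theorem exists_isChordalUniformizing_of_closedBall (hsc : ∀ D : JordanDomain, D.isSimplyConnected)
    (hRM : ∀ {U : Set ℂ}, exists_conformalEquiv_ball (U := U))
    (hC : JordanDomain.exists_continuousOn_closedBall_extension) : exists_isChordalUniformizing := by
  intro D
  -- Riemann map and its Carathéodory extension
  obtain ⟨ψ⟩ := hRM D.isOpen (hsc D.toJordanDomain) D.carrier_ne_univ
  obtain ⟨Ψ, hΨc, hΨeq⟩ := hC D.toJordanDomain ψ.symm
  have hsph : SurjOn Ψ (sphere 0 1) (frontier D.carrier) :=
    JordanDomain.surjOn_frontier_of_extension hΨc hΨeq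
  -- circle preimages of the two marked points
  obtain ⟨ζa, hζa, hΨa⟩ := hsph (D.pt_mem_frontier 0)
  obtain ⟨ζb, hζb, hΨb⟩ := hsph (D.pt_mem_frontier 1)
  rw [mem_sphere_zero_iff_norm] at hζa hζb
  have hab : D.pt 0 ≠ D.pt 1 := fun h ↦ absurd (D.pt_injective h) (by decide)
  have hζab : ζa ≠ ζb := by
    rintro rfl
    exact hab (hΨa.symm.trans hΨb)
  have hζb0 : ζb ≠ 0 := norm_ne_zero_iff.1 (by rw [hζb]; exact one_ne_zero)
  -- the rotated Riemann map `ψ₂ = ψ ∘ (ζb ·)` and its extension `Ψ₂ = Ψ ∘ (ζb ·)`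
  set ψ₂ : ConformalEquiv (ball (0 : ℂ) 1) D.carrier := (rotBall ζb hζb).trans ψ.symm with hψ₂
  set Ψ₂ : ℂ → ℂ := fun w ↦ Ψ (ζb * w) with hΨ₂
  have hrot : MapsTo (fun w : ℂ ↦ ζb * w) (closedBall 0 1) (closedBall 0 1) := fun w hw ↦ by
    rw [mem_closedBall_zero_iff] at hw ⊢
    rwa [norm_mul, hζb, one_mul]
  have hΨ₂c : ContinuousOn Ψ₂ (closedBall 0 1) :=
    hΨc.comp (continuous_const_mul ζb).continuousOn hrot
  have hΨ₂eq : EqOn Ψ₂ ψ₂ (ball 0 1) := fun w hw ↦ hΨeq ((rotBall ζb hζb).mapsTo hw)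
  -- the rotated preimage `ζ` of `a` and its real Cayley preimage `u`
  set ζ : ℂ := ζb⁻¹ * ζa with hζ
  have hζ1 : ‖ζ‖ = 1 := by rw [hζ, norm_mul, norm_inv, hζa, hζb, inv_one, one_mul]
  have hζne : ζ ≠ 1 := by
    intro h
    apply hζab
    have : ζb * ζ = ζb := by rw [h, mul_one]
    rwa [hζ, ← mul_assoc, mul_inv_cancel₀ hζb0, one_mul] at this
  have hζbζ : ζb * ζ = ζa := by rw [hζ, ← mul_assoc, mul_inv_cancel₀ hζb0, one_mul]
  set u : ℝ := (cayleyInvFun ζ).re with hu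
  have hcu : cayleyFun u = ζ := by
    rw [hu, ← cayleyInvFun_eq_ofReal_re hζ1, cayleyFun_cayleyInvFun hζne]
  -- the uniformizing map
  set φ' : ConformalEquiv upperHalfPlaneSet D.carrier := cayley.trans ψ₂ with hφ'
  have hΨ₂eq' : EqOn Ψ₂ (cayley.symm.trans φ') (ball 0 1) := fun w hw ↦ by
    rw [hΨ₂eq hw]
    change ψ₂ w = ψ₂ (cayley (cayley.symm w))
    rw [cayley.apply_symm_apply hw]
  refine ⟨(addRealUpperHalfPlane u).trans φ', ?_, ?_⟩
  · -- boundary value `a` at `0`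
    have h1 : Tendsto φ' (𝓝[upperHalfPlaneSet] u) (𝓝 (Ψ₂ (cayleyFun u))) :=
      JordanDomain.tendsto_nhdsWithin_of_extension φ' hΨ₂c hΨ₂eq' (by simp)
    rw [hcu, hΨ₂] at h1
    simp only [hζbζ, hΨa] at h1
    exact h1.comp (tendsto_add_real_nhdsWithin_zero u)
  · -- boundary value `b` at `∞`
    have h1 : Tendsto φ' (cocompact ℂ ⊓ 𝓟 upperHalfPlaneSet) (𝓝 (Ψ₂ 1)) :=
      JordanDomain.tendsto_cocompact_of_extension φ' hΨ₂c hΨ₂eq'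
    rw [hΨ₂] at h1
    simp only [mul_one, hΨb] at h1
    exact h1.comp (tendsto_add_real_cocompact_inf u)

/-- **Existence of chordal uniformizing maps from the disc-form theorems** (the original
reduction): as `exists_isChordalUniformizing_of_closedBall`, with Carathéodory's theorem in the
full disc form of Pommerenke (1992), Thm 2.6 (`hC`). Lawler (2005), Ch. 6; Ahlfors (1979), Ch. 6
§1.1. [cite: AhlforsCA1979, Ch. 6 §1.1 Thm. 1] -/
theorem exists_isChordalUniformizing_of_disc (hsc : ∀ D : JordanDomain, D.isSimplyConnected)
    (hRM : ∀ {U : Set ℂ}, exists_conformalEquiv_ball (U := U))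
    (hC : JordanDomain.exists_continuousOn_extension) : exists_isChordalUniformizing :=
  exists_isChordalUniformizing_of_closedBall hsc hRM
    (JordanDomain.exists_continuousOn_closedBall_extension_of_extension hC)

end MarkedDomain

end Literature.Probability.RandomPlanarGeometry
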